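import Mathlib.RingTheory.Norm.Defs
import Mathlib.RingTheory.Valuation.Discrete.Basic
import Mathlib.RingTheory.Valuation.ValuationSubring
import Mathlib.FieldTheory.AbsoluteGaloisGroup
import Mathlib.Topology.Algebra.Group.Quotient
import Literature.NumberTheory.GaloisRepresentations.LocalField
import Literature.NumberTheory.GaloisRepresentations.AbsGaloisGroup
import Literature.NumberTheory.GaloisRepresentations.LocalGaloisGroup
import Literature.NumberTheory.GaloisRepresentations.WeilGroup
import HarnessLib

/-!
# The local reciprocity map (trunk GalRep; Serre, *Local Fields*, Ch. XIII §4 and Ch. XIV §6)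

Let `F` be a non-archimedean local field (`[IsNonarchimedeanLocalField F]`, Mathlib), with
absolute Galois group `Γ_F = Field.absoluteGaloisGroup F`, its topological abelianisation
`Γ_F^ab = Field.absoluteGaloisGroupAbelianization F = Γ_F ⧸ closure [Γ_F, Γ_F]` (Mathlib; this
is the Galois group `𝔄_F = G(F^ab/F)` of the maximal abelian extension), Weil group
`W_F = Literature.weilSubgroup F ≤ Γ_F` and inertia group `I_F = Literature.absInertia F ≤ Γ_F` (items C4, C7).

Local class field theory (Serre, *Local Fields* (1979), Ch. XIII §4 and Ch. XIV §6; Serre,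
*Local class field theory*, Ch. VI of Cassels–Fröhlich (1967), §2) constructs the *reciprocity
map* `θ_F : Fˣ → 𝔄_F`, `x ↦ (x, */F)`, as the limit of the inverses of the isomorphisms
`G^a_{L/F} ≅ Fˣ/N Lˣ` given by cup product with the fundamental classes (Serre XIII §4, Thm. 1
and Cor. to Prop. 8), and proves:

* `θ_F` is injective (XIV §6, Cor. 2 (i) to Thm. 1: the intersection of the norm groups is `{1}`);
* its image is `𝔄_F^0`, the automorphisms of `F^ab` inducing an *integral* power of the
  Frobenius on `F_nr`, i.e. the image of `W_F` in `𝔄_F` (XIV §6, Remark 2: `x ↦ (x, */F)` is an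
  isomorphism of topological groups `Fˣ ≅ 𝔄_F^0`, `𝔄_F^0` topologised with `𝔗_F` open);
* `θ_F` maps the units `U_F` isomorphically and homeomorphically onto the inertia group
  `𝔗_F = G(F^ab/F_nr)` of `F^ab/F`, the image of `I_F` in `𝔄_F` (XIII §4, Cor. to Prop. 13 and the
  diagram p. 201; XIV §6, Cor. 2 (ii));
* `(x, L/F) = F_F^{v(x)}` for `L/F` unramified, `F_F` the *arithmetic* Frobenius (XIII §4,
  Prop. 13): a uniformiser is sent to the class of an arithmetic Frobenius;
* norm functoriality (XIII §4, Prop. 10 (a), at finite level; in the limit: Cassels–Fröhlich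
  Ch. VI §2.4, second diagram, valid also for inseparable `E/F`): for a finite extension `E/F`,
  `θ_F ∘ N_{E/F} = i ∘ θ_E` with `i : 𝔄_E → 𝔄_F` induced by `Γ_E → Γ_F`.

## Contents

* `Literature.absGaloisAbProj F : Γ_F →* Γ_F^ab` (the quotient map, an `abbrev`) and
  `Literature.absGaloisRestrictAb F E : Γ_E^ab →ₜ* Γ_F^ab`, the continuous homomorphism induced by the
  restriction `Literature.absGaloisRestrict F E` (a real definition: a continuous homomorphism maps
  `closure [Γ_E, Γ_E]` into `closure [Γ_F, Γ_F]`), with `absGaloisRestrictAb_mk`.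
* `Literature.IsLocalReciprocityMap F θ`: the predicate bundling the four printed properties above of a
  homomorphism `θ : Fˣ →* Γ_F^ab` (injective; range `=` image of `W_F`; units `≃ₜ` image of
  `I_F`; uniformiser `↦` arithmetic Frobenius class), and `Literature.IsNormCompatible F E θF θE`.
* Named facts (D-0014, no `sorry`): `Literature.exists_isLocalReciprocityMap F` (existence of such a
  `θ_F`: Serre XIII §4 + XIV §6) and `Literature.exists_isLocalReciprocityMap_normCompatible F E`
  (the same for a finite extension `E/F`, together with norm functoriality, XIII §4 Prop. 10 (a)).

These are the inputs from which `Literature.LocalArtinData F` (the local Artin map on the Weil group,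
`Literature/NumberTheory/GaloisRepresentations/LocalClassFieldTheory.lean`) and the facts
`Literature.NumberTheory.GaloisRepresentations.nonempty_localArtinData`, `Literature.NumberTheory.GaloisRepresentations.exists_isCompatible` of that file are assembled (Tate,
*Number theoretic background* (Corvallis 1979), (1.4.1)–(1.4.6): pull `θ_F⁻¹` back along
`W_F ↠ 𝔄_F^0`); the assembly lives in the sibling `LocalClassFieldTheoryProofs.lean`.

## Faithfulness notes

* Serre defines *the* reciprocity map; Lean has no construction of it (Mathlib, this pin, has
  group cohomology `H^n`, Hilbert 90 and the Tate complex, but no cup products, Brauer groups of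
  local fields, class formations or Lubin–Tate theory), so the facts below are the *existential*
  consequences "there is a `θ` with the printed properties" of the cited theorems — weaker than,
  and implied by, the source.  Uniqueness (characterisation of `θ_F` by these properties plus
  norm functoriality over all finite `E ⊆ F̄`) is not stated.
* `𝔄_F^0` is rendered as `(weilSubgroup F).map (absGaloisAbProj F)` and `𝔗_F` as
  `(absInertia F).map (absGaloisAbProj F)`: `W_F` (resp. `I_F`) is the subgroup of `Γ_F` acting on
  the residue field of `F̄` as an integral power of Frobenius (resp. trivially), i.e. the preimage
  of `F^ℤ ⊆ G(F_nr/F)` (resp. `G(F̄/F_nr)`), and `G(F^ab/F_nr)` is the image of `G(F̄/F_nr)`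
  (Serre, *Local Fields*, Ch. I §7 Prop. 22 (b) for images of inertia groups in quotients).
* Sign: Serre's (and Cassels–Fröhlich's) normalisation is the *arithmetic* one
  (`isFrobPow_one_of_isUniformizer`: uniformiser `↦` Frobenius `x ↦ x^q`, `IsFrobPow σ 1` in the
  convention of `LocalGaloisGroup`); Deligne's normalisation used by `LocalArtinData` is obtained
  by composing with inversion.
* Only the topological statement needed downstream is recorded (units `→` `𝔗_F` is an
  embedding); continuity of `θ_F` on all of `Fˣ` (norm groups are open, XIV §6 Cor. 1) is implied
  by it together with `range_eq` but is not a separate clause.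

## Mathlib search

`rg -i "reciprocity map|local class field|norm residue|LubinTate|fundamental class"` over Mathlib
(this pin) finds nothing relevant (`reciprocity` only quadratic/Jacobi reciprocity;
`Mathlib/RepresentationTheory/Homological/GroupCohomology/Hilbert90.lean` and
`…/TateCohomology/Basic.lean` are the closest cohomological tools).  Mathlib anchors used:
`Field.absoluteGaloisGroupAbelianization` (`Mathlib/FieldTheory/AbsoluteGaloisGroup.lean`),
`QuotientGroup.map`, `ValuationSubring.unitGroup`, `Valuation.IsUniformizer`, `Algebra.norm`,
`Topology.IsEmbedding`.  Nothing here duplicates a Mathlib declaration.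

## References

* J.-P. Serre, *Local Fields*, GTM 67, Springer 1979, Ch. XIII §4 (Thm. 1, Prop. 8 and Cor.,
  Props. 9–13 and Cor.), Ch. XIV §6 (Thm. 1, Cor. 1–2, Remark 2).  [SerreLocalFields1979]
* J.-P. Serre, *Local class field theory*, Ch. VI in: J. W. S. Cassels, A. Fröhlich (eds.),
  *Algebraic Number Theory*, Academic Press 1967, §2.2–§2.5.  [CasselsFrohlichANT1967]
* J. Tate, *Number theoretic background*, Proc. Sympos. Pure Math. XXXIII (Corvallis 1977),
  Part 2, AMS 1979, (1.4.1)–(1.4.6).  [Corvallis1979]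
-/

noncomputable section

open ValuativeRel Field Topology

namespace Literature.NumberTheory.GaloisRepresentations


/-! ### The abelianised absolute Galois group and restriction -/

section Abelianization

/-- The projection `Γ_F →* Γ_F^ab = Γ_F ⧸ closure [Γ_F, Γ_F]` onto the topological
abelianisation (`Field.absoluteGaloisGroupAbelianization`, Mathlib), i.e. restriction of
automorphisms of `F̄` to the maximal abelian extension `F^ab`.
Ref: Serre, *Local Fields* (1979), Ch. XIII §4, p. 197 (`𝔄_E = G(E^a/E)`). [folklore] -/
abbrev absGaloisAbProj (F : Type*) [Field F] :
    absoluteGaloisGroup F →* absoluteGaloisGroupAbelianization F :=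
  QuotientGroup.mk' (commutator (absoluteGaloisGroup F)).topologicalClosure

variable (F E : Type*) [Field F] [Field E] [Algebra F E]

/-- A continuous homomorphism maps the closure of the commutator subgroup into the closure of the
commutator subgroup: `closure [Γ_E, Γ_E] ≤ res⁻¹ (closure [Γ_F, Γ_F])` for the restriction
`res = absGaloisRestrict F E : Γ_E → Γ_F`.
Ref: Serre, *Local class field theory* (Cassels–Fröhlich, Ch. VI), §2.4 (the map
`G_{K'}^{ab} → G_K^{ab}` induced by `G_{K'} → G_K`). [folklore] -/
theorem topologicalClosure_commutator_le_comap_absGaloisRestrict :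
    (commutator (absoluteGaloisGroup E)).topologicalClosure ≤
      ((commutator (absoluteGaloisGroup F)).topologicalClosure).comap
        (absGaloisRestrict F E).toMonoidHom := by
  refine Subgroup.topologicalClosure_minimal _ ?_ ?_
  · intro σ hσ
    rw [Subgroup.mem_comap]
    refine Subgroup.le_topologicalClosure _ ?_
    have h : (commutator (absoluteGaloisGroup E)).map (absGaloisRestrict F E).toMonoidHom ≤
        commutator (absoluteGaloisGroup F) := by
      rw [commutator, Subgroup.map_commutator]
      exact Subgroup.commutator_mono le_top le_top
    exact h ⟨σ, hσ, rfl⟩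
  · exact (Subgroup.isClosed_topologicalClosure _).preimage (absGaloisRestrict F E).continuous

/-- The homomorphism `Γ_E^ab → Γ_F^ab` (`G(E^ab/E) → G(F^ab/F)`) induced by the restriction
`absGaloisRestrict F E : Γ_E → Γ_F` on topological abelianisations, as a continuous homomorphism.
Like `absGaloisRestrict` it depends on the chosen embedding `F̄ → Ē` only up to an inner
automorphism of `Γ_F`, hence not at all on `Γ_F^ab`.
Ref: Serre, *Local class field theory* (Cassels–Fröhlich, Ch. VI), §2.4 (the map `i`).
[cite: CasselsFrohlichANT1967, Ch. VI §2.4] -/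
def absGaloisRestrictAb :
    absoluteGaloisGroupAbelianization E →ₜ* absoluteGaloisGroupAbelianization F where
  toMonoidHom := QuotientGroup.map _ _ (absGaloisRestrict F E).toMonoidHom
    (topologicalClosure_commutator_le_comap_absGaloisRestrict F E)
  continuous_toFun := by
    refine (QuotientGroup.isQuotientMap_mk _).continuous_iff.mpr ?_
    exact QuotientGroup.continuous_mk.comp (absGaloisRestrict F E).continuous

variable {F E} in
/-- `absGaloisRestrictAb` on the class of `σ ∈ Γ_E` is the class of `res σ ∈ Γ_F`.
Ref: Serre, *Local class field theory* (Cassels–Fröhlich, Ch. VI), §2.4. [folklore] -/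
@[simp]
theorem absGaloisRestrictAb_mk (σ : absoluteGaloisGroup E) :
    absGaloisRestrictAb F E (absGaloisAbProj E σ) = absGaloisAbProj F (absGaloisRestrict F E σ) :=
  rfl

variable {F E} in
/-- `absGaloisRestrictAb ∘ absGaloisAbProj E = absGaloisAbProj F ∘ absGaloisRestrict`.
Ref: Serre, *Local class field theory* (Cassels–Fröhlich, Ch. VI), §2.4. [folklore] -/
theorem absGaloisRestrictAb_comp_absGaloisAbProj :
    (absGaloisRestrictAb F E).toMonoidHom.comp (absGaloisAbProj E) =
      (absGaloisAbProj F).comp (absGaloisRestrict F E).toMonoidHom :=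
  rfl

end Abelianization

/-! ### Norm functoriality -/

section NormCompatible

variable (F E : Type*) [Field F] [Field E] [Algebra F E]

/-- Norm functoriality of a pair of reciprocity maps along a finite extension `E/F`:
`θ_F (N_{E/F} x) = i (θ_E x)` for all `x ∈ Eˣ`, where `i = absGaloisRestrictAb F E :
G(E^ab/E) → G(F^ab/F)` is induced by `Γ_E → Γ_F` and the norm acts on units by
`Units.map (Algebra.norm F)`.
Ref: Serre, *Local Fields* (1979), Ch. XIII §4, Prop. 10 (a) (finite level); Serre, *Local class
field theory* (Cassels–Fröhlich, Ch. VI), §2.4, second diagram (limit form, valid also for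
inseparable `E/F`). [cite: SerreLocalFields1979, Ch. XIII §4 Prop. 10] -/
def IsNormCompatible (θF : Fˣ →* absoluteGaloisGroupAbelianization F)
    (θE : Eˣ →* absoluteGaloisGroupAbelianization E) : Prop :=
  ∀ x : Eˣ, θF (Units.map (Algebra.norm F : E →* F) x) = absGaloisRestrictAb F E (θE x)

variable {F E} in
/-- Unfolding lemma for `IsNormCompatible`.
Ref: Serre, *Local Fields* (1979), Ch. XIII §4, Prop. 10 (a). [folklore] -/
theorem isNormCompatible_iff (θF : Fˣ →* absoluteGaloisGroupAbelianization F)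
    (θE : Eˣ →* absoluteGaloisGroupAbelianization E) :
    IsNormCompatible F E θF θE ↔ (θF.comp (Units.map (Algebra.norm F : E →* F))) =
      (absGaloisRestrictAb F E).toMonoidHom.comp θE :=
  ⟨fun h => MonoidHom.ext fun x => h x, fun h x => DFunLike.congr_fun h x⟩

end NormCompatible

/-! ### The printed properties of the reciprocity map -/

section Reciprocity

variable (F : Type*) [Field F] [ValuativeRel F] [TopologicalSpace F] [IsNonarchimedeanLocalField F]

/-- `IsLocalReciprocityMap F θ`: the homomorphism `θ : Fˣ →* Γ_F^ab = 𝔄_F` has the printed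
properties of Serre's reciprocity map `x ↦ (x, */F)` (arithmetic normalisation):
it is injective, its image is the image `𝔄_F^0` of the Weil group, it restricts to a topological
isomorphism of the unit group `U_F` onto the image `𝔗_F` of the inertia group, and it sends
uniformisers to classes of arithmetic Frobenius elements.
Ref: Serre, *Local Fields* (1979), Ch. XIII §4 (Prop. 13 and Cor.), Ch. XIV §6 (Cor. 2 to Thm. 1,
Remark 2). [cite: SerreLocalFields1979, Ch. XIV §6 Cor. 2 and Remark 2] -/
structure IsLocalReciprocityMap (θ : Fˣ →* absoluteGaloisGroupAbelianization F) : Prop where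
  /-- `θ` is injective: the intersection of all norm groups of `Fˣ` is `{1}`.
  Ref: Serre, *Local Fields*, Ch. XIV §6, Cor. 2 (i) to Thm. 1. -/
  injective : Function.Injective θ
  /-- The image of `θ` is `𝔄_F^0`, the image of the Weil group `W_F` in `𝔄_F = Γ_F^ab` (classes
  inducing an integral power of Frobenius on `F_nr`).
  Ref: Serre, *Local Fields*, Ch. XIV §6, Remark 2. -/
  range_eq : θ.range = (weilSubgroup F).map (absGaloisAbProj F)
  /-- `θ` maps the unit group `U_F = 𝒪_Fˣ` onto `𝔗_F`, the inertia group of `F^ab/F`, i.e. the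
  image of `I_F` in `Γ_F^ab`.
  Ref: Serre, *Local Fields*, Ch. XIII §4, Cor. to Prop. 13 (and the diagram p. 201). -/
  map_unitGroup :
    ((valuation F).valuationSubring.unitGroup).map θ = (absInertia F).map (absGaloisAbProj F)
  /-- `U_F → 𝔗_F` is an isomorphism of topological groups: `θ` restricted to `U_F` (with its
  topology from `Fˣ`) is an embedding into `Γ_F^ab` (Krull quotient topology).
  Ref: Serre, *Local Fields*, Ch. XIV §6, Cor. 2 (ii) to Thm. 1. -/
  isEmbedding_unitGroup :
    IsEmbedding fun u : (valuation F).valuationSubring.unitGroup => θ (u : Fˣ)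
  /-- Normalisation `(ϖ, L/F) = F_F` (arithmetic Frobenius) for `L/F` unramified: every
  `σ ∈ Γ_F` in the class `θ ϖ` of a uniformiser `ϖ` is an arithmetic Frobenius,
  `IsFrobPow σ 1` (it acts as `x ↦ x ^ q_F` on the residue field of `F̄`).
  Ref: Serre, *Local Fields*, Ch. XIII §4, Prop. 13. -/
  isFrobPow_one_of_isUniformizer : ∀ x : Fˣ, (valuation F).IsUniformizer (x : F) →
    ∀ σ : absoluteGaloisGroup F, absGaloisAbProj F σ = θ x → IsFrobPow σ 1

/-- **Local class field theory: the reciprocity map** (existential form).  For a non-archimedean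
local field `F` there is a homomorphism `θ : Fˣ →* G(F^ab/F)` which is injective, has image
`𝔄_F^0` (the image of the Weil group), maps `U_F` homeomorphically onto the inertia group `𝔗_F`,
and sends uniformisers to arithmetic Frobenius classes — namely Serre's `x ↦ (x, */F)`.
This is the conjunction of the cited printed statements about the reciprocity map, weakened to
an existence statement (see the module docstring, "Faithfulness notes").
Ref: Serre, *Local Fields* (1979), Ch. XIII §4, Thm. 1, Cor. to Prop. 8, Prop. 13 and Cor.;
Ch. XIV §6, Thm. 1, Cor. 2, Remark 2; Serre in Cassels–Fröhlich (1967), Ch. VI §2.2–2.5.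
[cite: SerreLocalFields1979, Ch. XIV §6 Thm. 1 Cor. 2 and Remark 2] -/
def exists_isLocalReciprocityMap : Prop :=
  ∃ θ : Fˣ →* absoluteGaloisGroupAbelianization F, IsLocalReciprocityMap F θ

variable (E : Type*) [Field E] [ValuativeRel E] [TopologicalSpace E] [IsNonarchimedeanLocalField E]
  [Algebra F E]

/-- **Local class field theory: reciprocity maps compatible with the norm.**  For a finite
extension `E/F` of non-archimedean local fields (the valuation of `E` extending that of `F`)
there are reciprocity maps `θ_F`, `θ_E` as in `exists_isLocalReciprocityMap` with
`θ_F ∘ N_{E/F} = i ∘ θ_E` (`IsNormCompatible`).  In the source both maps are *the* canonical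
reciprocity maps and the compatibility is Prop. 10 (a) of Ch. XIII §4 (image of `(x, L/E)` in
`G^a_{L/F}` is `(N_{E/F} x, L/F)`, `L/F` finite Galois), passed to the limit over `L`
(Cassels–Fröhlich Ch. VI §2.4); here the pair is asserted to exist (see "Faithfulness notes").
Ref: Serre, *Local Fields* (1979), Ch. XIII §4, Prop. 10 (a), with Ch. XIV §6 Cor. 2 and Remark 2;
Serre in Cassels–Fröhlich (1967), Ch. VI §2.4. [cite: SerreLocalFields1979, Ch. XIII §4 Prop. 10] -/
def exists_isLocalReciprocityMap_normCompatible [FiniteDimensional F E] [ValuativeExtension F E] :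
    Prop :=
  ∃ (θF : Fˣ →* absoluteGaloisGroupAbelianization F)
    (θE : Eˣ →* absoluteGaloisGroupAbelianization E),
    IsLocalReciprocityMap F θF ∧ IsLocalReciprocityMap E θE ∧ IsNormCompatible F E θF θE

variable {F E} in
/-- The pair version implies the single-field version (project to the first component).
Ref: Serre, *Local Fields* (1979), Ch. XIII §4. [folklore] -/
theorem exists_isLocalReciprocityMap_of_normCompatible [FiniteDimensional F E]
    [ValuativeExtension F E] (h : exists_isLocalReciprocityMap_normCompatible F E) :
    exists_isLocalReciprocityMap F ∧ exists_isLocalReciprocityMap E := by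
  obtain ⟨θF, θE, hF, hE, -⟩ := h
  exact ⟨⟨θF, hF⟩, ⟨θE, hE⟩⟩

end Reciprocity

end Literature.NumberTheory.GaloisRepresentations
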